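import Mathlib
import Summits.ValiantsHypothesis.ValiantsHypothesis.Theorems.GrenetZeonTwoDimCoefficientsDualUnipotentDualCharpoly

/-!
# Crux `GrenetZeon.TwoDimCoefficients` (stmt-ValiantsHypothesis-8062), stub `stub_dualUnipotent`; rung 24318:
# the JORDAN GAP of the nilpotent pencil at points off the permanental hypersurface

Pointwise consequence of the dual Cayley–Hamilton coupling ✓ `DualCharpoly.exists_coupled_pencil_of_dualUnipotentRepr`
(`Σ_{i<m} N^i M N^{m-1-i} = per_n • N^{m-n}` for the constrained pencil `(N, M)` of `DualUnipotentRepr n m`, `n ≤ m`).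
Evaluate at a point `x` with `per_n(x) ≠ 0` and apply both sides to a vector `w` with `N(x)·N(x)^{m-n} w = 0`: the words
with `≥ m - n + 1` trailing letters `N(x)` die, the others start with `N(x)^{n-1}`, so

* `mulVec_mem_range_of_coupling` (pure linear algebra over a field, from the identity `Σ_i L^i Y L^{m-1-i} = c • L^s`, `c ≠ 0`,
  `s + n = m`): **`ker L ∩ Im L^s ⊆ Im L^{n-1}`**;
* `eval_coupling` — the coupling identity evaluated at a point;
* ★ `jordanGap_of_dualUnipotentRepr` — for the constrained pencil of a unipotent dual representation of `per_n` and every point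
  `x` with `per_n(x) ≠ 0`: `ker N(x) ∩ Im N(x)^{m-n} ⊆ Im N(x)^{n-1}`.

JORDAN READING (paper, for the `slow_core` / (c) programme on 24318 and the CALIBRATION memo of 8062): `dim(ker L ∩ Im L^j)` is the
number of Jordan blocks of `L` of size `> j`; the inclusion says that at every point off `Z(per_n)` the value `N(x)` has NO Jordan
block with size in the open interval `(m - n, n)` — and since two blocks of size `≥ n` need `2n ≤ m`, in the regime `m < 2n` the
Jordan type of `N(x)` is `λ₁ ≥ n > m - n ≥ λ₂ ≥ λ₃ ≥ …` (one long block, all others of size `≤ m - n`; generically `λ₁` = the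
nilindex of the pencil).  Equivalently `rank N(x)^j - rank N(x)^{j+1} ≤ 1` for `m - n ≤ j`.  (Honest note: given the universal
first-order Cayley–Hamilton identity ✓ `DualCharpoly.powDeriv_card_eq`, the coupling identity is EQUIVALENT to the trace constraints
`tr(N^j M) = δ_{j,n-1}·per_n`; this file extracts a pointwise structural consequence of them.)

HONEST FRAMING: support lemma (`--supports stmt-ValiantsHypothesis-8062`, helper); closes no stub; `stub_dualUnipotent`
(`DualUnipotentBound`), (c) `SlowCore.LongMassSlowLawInv`, 24318, 8062 and `VP ≠ VNP` stay OPEN / NOT proved.  No sorry, no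
definitions, no instances, no notation, no named facts. [folklore]
-/

set_option linter.dupNamespace false
set_option autoImplicit false

noncomputable section

namespace Summit.ValiantsHypothesis.ValiantsHypothesis.Cruxes.TwoDimCoefficients.DimTwoCases.DualCharpoly

open Matrix
open scoped BigOperators
open Literature.Computability.AlgebraicComplexity

/-! ## §1 Linear algebra: `Σ_i L^i Y L^{m-1-i} = c • L^s`, `c ≠ 0` ⇒ `ker L ∩ Im L^s ⊆ Im L^{m-s-1}` -/

/-- From the coupling identity `Σ_{i<m} L^i Y L^{m-1-i} = c • L^s` with `c ≠ 0` and `s + n = m`, `1 ≤ n`: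
every vector `L^s w` killed by `L` lies in the range of `L^{n-1}`. -/
theorem mulVec_mem_range_of_coupling {K : Type*} [Field K] {m : ℕ} (L Y : Matrix (Fin m) (Fin m) K) {c : K}
    (hc : c ≠ 0) {s n : ℕ} (hsn : s + n = m) (hn : 1 ≤ n)
    (hcoup : ∑ i ∈ Finset.range m, L ^ i * Y * L ^ (m - 1 - i) = c • L ^ s)
    (w : Fin m → K) (hv : L.mulVec ((L ^ s).mulVec w) = 0) :
    ∃ u : Fin m → K, (L ^ s).mulVec w = (L ^ (n - 1)).mulVec u := by
  -- apply the identity to `w`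
  have happ : c • (L ^ s).mulVec w = ∑ i ∈ Finset.range m, (L ^ i * Y * L ^ (m - 1 - i)).mulVec w := by
    rw [← Matrix.smul_mulVec, ← hcoup, Matrix.sum_mulVec]
  -- terms with `i < n - 1` vanish: `L^{m-1-i} w = L^{m-2-i-s} (L (L^s w)) = 0`
  have hzero : ∀ i ∈ Finset.range m, i < n - 1 → (L ^ i * Y * L ^ (m - 1 - i)).mulVec w = 0 := by
    intro i _ hi
    have hsplit : m - 1 - i = (m - 2 - i - s) + 1 + s := by omega
    rw [hsplit, pow_add, pow_succ]
    simp only [← Matrix.mulVec_mulVec]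
    rw [hv, Matrix.mulVec_zero, Matrix.mulVec_zero, Matrix.mulVec_zero]
  -- terms with `i ≥ n - 1` lie in `Im L^{n-1}`
  have hrest : ∀ i ∈ Finset.range m, ¬ i < n - 1 →
      (L ^ i * Y * L ^ (m - 1 - i)).mulVec w =
        (L ^ (n - 1)).mulVec ((L ^ (i - (n - 1)) * Y * L ^ (m - 1 - i)).mulVec w) := by
    intro i _ hi
    obtain ⟨t, rfl⟩ := Nat.exists_eq_add_of_le (Nat.not_lt.mp hi)
    rw [Nat.add_sub_cancel_left, pow_add, Matrix.mulVec_mulVec]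
    simp only [Matrix.mul_assoc]
  refine ⟨c⁻¹ • ∑ i ∈ Finset.range m,
    if i < n - 1 then 0 else ((L ^ (i - (n - 1)) * Y * L ^ (m - 1 - i)).mulVec w), ?_⟩
  rw [Matrix.mulVec_smul, Matrix.mulVec_sum]
  have hsum : ∑ i ∈ Finset.range m, (L ^ (n - 1)).mulVec
      (if i < n - 1 then 0 else ((L ^ (i - (n - 1)) * Y * L ^ (m - 1 - i)).mulVec w)) =
      ∑ i ∈ Finset.range m, (L ^ i * Y * L ^ (m - 1 - i)).mulVec w := by
    refine Finset.sum_congr rfl fun i hi => ?_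
    split_ifs with h
    · rw [Matrix.mulVec_zero, hzero i hi h]
    · rw [hrest i hi h]
  rw [hsum, ← happ, smul_smul, inv_mul_cancel₀ hc, one_smul]

/-! ## §2 The pencil of a unipotent dual representation of `per_n` -/

variable {n m : ℕ}

/-- The coupling identity evaluated at a point `x`:
`Σ_{i<m} N(x)^i M(x) N(x)^{m-1-i} = per_n(x) • N(x)^{m-n}`. -/
theorem eval_coupling (N M : AffMat n m)
    (hcoup : ∑ i ∈ Finset.range m, N ^ i * M * N ^ (m - 1 - i) = perPoly (Fin n) ℂ • N ^ (m - n))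
    (x : Fin n × Fin n → ℂ) :
    ∑ i ∈ Finset.range m, (N.map (MvPolynomial.eval x)) ^ i * M.map (MvPolynomial.eval x) *
        (N.map (MvPolynomial.eval x)) ^ (m - 1 - i) =
      MvPolynomial.eval x (perPoly (Fin n) ℂ) • (N.map (MvPolynomial.eval x)) ^ (m - n) := by
  have hp : (N.map (MvPolynomial.eval x)) ^ (m - n) = (N ^ (m - n)).map (MvPolynomial.eval x) := by
    rw [← RingHom.mapMatrix_apply, ← RingHom.mapMatrix_apply, map_pow]
  rw [← map_eval_sum_pow_mul, hcoup, hp]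
  ext i j
  simp [Matrix.smul_apply]

/-- ★ **JORDAN GAP.**  For the constrained pencil `(N, M)` of a unipotent dual representation of `per_n` (`n ≥ 1`; then `n ≤ m`,
`N^m = 0`, `per_n = tr(N^{n-1} M)`): at every point `x` with `per_n(x) ≠ 0`,
`ker N(x) ∩ Im N(x)^{m-n} ⊆ Im N(x)^{n-1}` — `N(x)` has no Jordan block with size strictly between `m - n` and `n`. -/
theorem jordanGap_of_dualUnipotentRepr (hn : 1 ≤ n) (hrep : DualUnipotentRepr n m) :
    ∃ N M : AffMat n m, (∀ i j, (N i j).IsHomogeneous 1) ∧ (∀ i j, (M i j).IsHomogeneous 1) ∧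
      N ^ m = 0 ∧ perPoly (Fin n) ℂ = (N ^ (n - 1) * M).trace ∧ n ≤ m ∧
      ∀ x : Fin n × Fin n → ℂ, MvPolynomial.eval x (perPoly (Fin n) ℂ) ≠ 0 →
        ∀ w : Fin m → ℂ, (N.map (MvPolynomial.eval x)).mulVec (((N.map (MvPolynomial.eval x)) ^ (m - n)).mulVec w) = 0 →
          ∃ u : Fin m → ℂ, ((N.map (MvPolynomial.eval x)) ^ (m - n)).mulVec w =
            ((N.map (MvPolynomial.eval x)) ^ (n - 1)).mulVec u := by
  obtain ⟨N, M, hN, hM, hnil, hper, -, hnm, hcoup⟩ := exists_coupled_pencil_of_dualUnipotentRepr hn hrep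
  refine ⟨N, M, hN, hM, hnil, hper, hnm, fun x hx w hw => ?_⟩
  exact mulVec_mem_range_of_coupling (N.map (MvPolynomial.eval x)) (M.map (MvPolynomial.eval x)) hx
    (s := m - n) (n := n) (by omega) hn (eval_coupling N M hcoup x) w hw

/-! ## §3 AT MOST ONE LONG BLOCK when `m < 2n` (appended): two independent cyclic chains of length `n` need `2n ≤ m`

With §2 this turns the Jordan gap into: for `m < 2n`, at every point off `Z(per_n)` the space `ker N(x) ∩ Im N(x)^{m-n}` contains
no two linearly independent vectors — `N(x)` has EXACTLY ONE Jordan block of size `> m - n` (it has size `≥ n`), all other blocks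
have size `≤ m - n` (`atMostOneLongBlock_of_dualUnipotentRepr`). -/

/-- If `L v₁ = L v₂ = 0`, `v_a = L^{n-1} w_a` and `v₁, v₂` are linearly independent, then the `2n` vectors `L^j w_a`
(`j < n`, `a = 1, 2`) are linearly independent; hence `2n ≤ m`. -/
theorem two_mul_le_of_two_cyclic {K : Type*} [Field K] (L : Matrix (Fin m) (Fin m) K) {n : ℕ} (hn : 1 ≤ n) (w : Fin 2 → Fin m → K)
    (hker : ∀ a, L.mulVec ((L ^ (n - 1)).mulVec (w a)) = 0)
    (hind : LinearIndependent K fun a => (L ^ (n - 1)).mulVec (w a)) : 2 * n ≤ m := by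
  -- the family
  let f : Fin 2 × Fin n → (Fin m → K) := fun p => (L ^ (p.2 : ℕ)).mulVec (w p.1)
  -- high powers kill: `L^k w_a = 0` for `k ≥ n`
  have hkill : ∀ a (k : ℕ), n ≤ k → (L ^ k).mulVec (w a) = 0 := by
    intro a k hk
    obtain ⟨t, rfl⟩ := Nat.exists_eq_add_of_le hk
    have : n + t = t + 1 + (n - 1) := by omega
    rw [this, pow_add, pow_succ, ← Matrix.mulVec_mulVec, ← Matrix.mulVec_mulVec, hker, Matrix.mulVec_zero]
  have hf : LinearIndependent K f := by
    rw [Fintype.linearIndependent_iff]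
    intro g hg
    -- by strong induction on the exponent
    have key : ∀ j₀ : ℕ, ∀ hj₀ : j₀ < n, ∀ a, g (a, ⟨j₀, hj₀⟩) = 0 := by
      intro j₀
      induction j₀ using Nat.strong_induction_on with
      | _ j₀ ih =>
        intro hj₀ a
        -- apply `L^{n-1-j₀}` to the relation
        have happ := congr_arg ((L ^ (n - 1 - j₀)).mulVec) hg
        rw [Matrix.mulVec_zero, Matrix.mulVec_sum] at happ
        -- each term: `g p • L^{n-1-j₀+j} w_a`, zero unless `j = j₀` (smaller `j`: coefficient zero; larger: killed)
        have hterm : ∀ p : Fin 2 × Fin n, (L ^ (n - 1 - j₀)).mulVec (g p • f p) =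
            if (p.2 : ℕ) = j₀ then g p • (L ^ (n - 1)).mulVec (w p.1) else 0 := by
          rintro ⟨b, j⟩
          simp only [f, Matrix.mulVec_smul, Matrix.mulVec_mulVec, ← pow_add]
          split_ifs with hj
          · have hexp : n - 1 - j₀ + (j : ℕ) = n - 1 := by omega
            rw [hexp]
          · rcases lt_or_gt_of_ne hj with hlt | hgt
            · rw [ih j hlt j.2 b, zero_smul]
            · rw [hkill b _ (by omega), smul_zero]
        rw [Finset.sum_congr rfl fun p _ => hterm p, Finset.sum_ite, Finset.sum_const_zero, add_zero] at happ
        -- the surviving sum is over `p` with `p.2 = j₀`, i.e. `Σ_b g (b, j₀) • v_b`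
        have hsum : ∑ p ∈ Finset.univ.filter (fun p : Fin 2 × Fin n => (p.2 : ℕ) = j₀),
            g p • (L ^ (n - 1)).mulVec (w p.1) = ∑ b : Fin 2, g (b, ⟨j₀, hj₀⟩) • (L ^ (n - 1)).mulVec (w b) := by
          refine Finset.sum_bij (fun p _ => p.1) (fun _ _ => Finset.mem_univ _) ?_ ?_ ?_
          · rintro ⟨b₁, j₁⟩ h₁ ⟨b₂, j₂⟩ h₂ hb
            simp only [Finset.mem_filter, Finset.mem_univ, true_and] at h₁ h₂
            simp only at hb
            ext <;> simp [hb]; omega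
          · intro b _
            exact ⟨(b, ⟨j₀, hj₀⟩), by simp, rfl⟩
          · rintro ⟨b, j⟩ h
            simp only [Finset.mem_filter, Finset.mem_univ, true_and] at h
            have : j = ⟨j₀, hj₀⟩ := Fin.ext h
            subst this; rfl
        rw [hsum] at happ
        exact (Fintype.linearIndependent_iff.mp hind) (fun b => g (b, ⟨j₀, hj₀⟩)) happ a
    rintro ⟨a, j⟩
    exact key j j.2 a
  have hcard := hf.fintype_card_le_finrank
  simp only [Fintype.card_prod, Fintype.card_fin, Module.finrank_fin_fun] at hcard
  exact hcard

/-- ★★ **One long block.**  For `m < 2n` and the constrained pencil `(N, M)` of a unipotent dual representation of `per_n` (`n ≥ 1`):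
at every point `x` with `per_n(x) ≠ 0`, any two vectors of `ker N(x) ∩ Im N(x)^{m-n}` are linearly DEPENDENT — i.e. `N(x)` has exactly
one Jordan block of size `> m - n` (of size `≥ n`) and all its other blocks have size `≤ m - n`. -/
theorem atMostOneLongBlock_of_dualUnipotentRepr (hn : 1 ≤ n) (hm : m < 2 * n) (hrep : DualUnipotentRepr n m) :
    ∃ N M : AffMat n m, (∀ i j, (N i j).IsHomogeneous 1) ∧ (∀ i j, (M i j).IsHomogeneous 1) ∧
      N ^ m = 0 ∧ perPoly (Fin n) ℂ = (N ^ (n - 1) * M).trace ∧ n ≤ m ∧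
      ∀ x : Fin n × Fin n → ℂ, MvPolynomial.eval x (perPoly (Fin n) ℂ) ≠ 0 →
        ∀ w : Fin 2 → Fin m → ℂ,
          (∀ a, (N.map (MvPolynomial.eval x)).mulVec (((N.map (MvPolynomial.eval x)) ^ (m - n)).mulVec (w a)) = 0) →
          ¬ LinearIndependent ℂ (fun a => ((N.map (MvPolynomial.eval x)) ^ (m - n)).mulVec (w a)) := by
  obtain ⟨N, M, hN, hM, hnil, hper, hnm, hgap⟩ := jordanGap_of_dualUnipotentRepr hn hrep
  refine ⟨N, M, hN, hM, hnil, hper, hnm, fun x hx w hw hind => ?_⟩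
  set L := N.map (MvPolynomial.eval x) with hL
  -- each `v_a = L^{m-n} w_a` is `L^{n-1} u_a`
  choose u hu using fun a => hgap x hx (w a) (hw a)
  have hker : ∀ a, L.mulVec ((L ^ (n - 1)).mulVec (u a)) = 0 := fun a => by rw [← hu a]; exact hw a
  have hind' : LinearIndependent ℂ fun a => (L ^ (n - 1)).mulVec (u a) := by
    have : (fun a => (L ^ (n - 1)).mulVec (u a)) = fun a => (L ^ (m - n)).mulVec (w a) := funext fun a => (hu a).symm
    rw [this]; exact hind
  have h2 := two_mul_le_of_two_cyclic L hn u hker hind'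
  omega

end Summit.ValiantsHypothesis.ValiantsHypothesis.Cruxes.TwoDimCoefficients.DimTwoCases.DualCharpoly

end
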